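import Literature.Geometry.DiscreteGeometry.FejesTothTammesBound

/-!
# Fejes Tóth's bound for eight points: `d₈ ≤ √(3 − cot² 40°) < 1.2569` — proved

Topic `Literature/Geometry/DiscreteGeometry`.  Theorem-only numeric companion of
`FejesTothTammesBound.lean`.  L. Fejes Tóth's 1943 bound `d_N ≤ √(3 − cot² ω_N)`,
`ω_N = Nπ/(6(N−2))` (`maxMinDist_le_fejesToth`), at `N = 8` has `ω₈ = 8π/36 = 2π/9 = 40°`, so
`d₈ ≤ √(3 − cot² 40°) = 1.256870…` (angular form `arccos ((cot² 40° − 1)/2) = 77.8695°`; this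
happens to be the exact Tammes value for SEVEN points, `cos a₇ = cot 40° · cot 80° =
(cot² 40° − 1)/2`, Schütte–van der Waerden 1951, as tabulated by Musin–Tarasov 2015, Table 7.2:
`d_max = 1.35908` rad for `N = 7`).  Here the decimal consequence is certified:

* `maxMinDist_eight_lt` : **`d₈ < 1.2569`** (chordal), hence (`minDist_eight_lt`,
  `exists_dist_lt_of_eight_le_card`) **among any eight points of the unit sphere `S² ⊂ ℝ³` two
  are at distance `< 1.2569`** — in particular eight points with pairwise distances `≥ 1.26`
  (angular separation `≥ 78.10°`) do not exist.

The only numerical input is `cos 40°`, pinned by the triple-angle formula: `c = cos (2π/9)`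
satisfies `4c³ − 3c = cos 120° = −1/2` and `c > cos 60° = 1/2`, whence `c > 0.76604`
(`cos 40° = 0.7660444…`), `cot² 40° = c²/(1 − c²) > 1.42017` and `3 − cot² 40° < 1.2569²`.

## References
* L. Fejes [Tóth], *Über eine Abschätzung des kürzesten Abstandes zweier Punkte eines auf einer
  Kugelfläche liegenden Punktsystems*, Jber. Deutsch. Math.-Verein. 53 (1943) 66–68, (1).
  [`FejesToth1943Tammes`]
* O. R. Musin, A. S. Tarasov, *Extreme problems of circle packings on a sphere and irreducible
  contact graphs*, Proc. Steklov Inst. Math. 288 (2015) 117–131, §3.2 and Table 7.2.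
  [`MusinTarasov2015`]
-/

noncomputable section

namespace Literature.Geometry.DiscreteGeometry

open Real

/-- `cos 120° = −1/2` through the triple-angle formula: `4 cos³ 40° − 3 cos 40° = −1/2`.
[folklore] -/
private theorem cos_two_pi_div_nine_cubic :
    4 * Real.cos (2 * π / 9) ^ 3 - 3 * Real.cos (2 * π / 9) = -(1 / 2) := by
  rw [← Real.cos_three_mul, show 3 * (2 * π / 9) = π - π / 3 by ring, Real.cos_pi_sub,
    Real.cos_pi_div_three]

/-- `cos 40° > cos 60° = 1/2`. [folklore] -/
private theorem one_half_lt_cos_two_pi_div_nine : (1 / 2 : ℝ) < Real.cos (2 * π / 9) := by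
  rw [← Real.cos_pi_div_three]
  exact Real.cos_lt_cos_of_nonneg_of_le_pi (by positivity) (by linarith [pi_pos])
    (by linarith [pi_pos])

/-- `cos 40° > 0.76604` (`cos 40° = 0.7660444…`): the cubic `4c³ − 3c + 1/2` is increasing on
`[1/2, ∞)` and still negative at `0.76604`. [folklore] -/
private theorem lt_cos_two_pi_div_nine : (0.76604 : ℝ) < Real.cos (2 * π / 9) := by
  have h3 := cos_two_pi_div_nine_cubic
  have h12 := one_half_lt_cos_two_pi_div_nine
  set c := Real.cos (2 * π / 9) with hc
  by_contra hle
  push Not at hle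
  have hq : 0 ≤ 4 * (c ^ 2 + c * 0.76604 + 0.76604 ^ 2) - 3 := by nlinarith
  nlinarith [mul_nonneg (sub_nonneg.2 hle) hq]

/-- `cos 40° < 0.76605`. [folklore] -/
private theorem cos_two_pi_div_nine_lt : Real.cos (2 * π / 9) < 0.76605 := by
  have h3 := cos_two_pi_div_nine_cubic
  have h12 := one_half_lt_cos_two_pi_div_nine
  set c := Real.cos (2 * π / 9) with hc
  by_contra hle
  push Not at hle
  have hq : 0 ≤ 4 * (c ^ 2 + c * 0.76605 + 0.76605 ^ 2) - 3 := by nlinarith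
  nlinarith [mul_nonneg (sub_nonneg.2 hle) hq]

/-- `3 − cot² 40° < 1.2569²` (`3 − cot² 40° = 1.579723…`, `1.2569² = 1.57979…`). [folklore] -/
private theorem three_sub_cot_sq_two_pi_div_nine_lt :
    3 - Real.cot (2 * π / 9) ^ 2 < 1.2569 ^ 2 := by
  have hc := lt_cos_two_pi_div_nine
  have hs : 0 < Real.sin (2 * π / 9) :=
    sin_pos_of_pos_of_lt_pi (by positivity) (by linarith [pi_pos])
  have hs2 : Real.sin (2 * π / 9) ^ 2 = 1 - Real.cos (2 * π / 9) ^ 2 := Real.sin_sq _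
  rw [Real.cot_eq_cos_div_sin, div_pow, sub_lt_comm, lt_div_iff₀ (pow_pos hs 2), hs2]
  have hc0 : 0 < Real.cos (2 * π / 9) := by linarith
  nlinarith [mul_lt_mul'' hc hc (by norm_num) (by norm_num)]

/-- `1.2569² < 3 − cot² 40° + 0.0002`, i.e. the bound `√(3 − cot² 40°)` exceeds `1.2568`
(`= 1.256870…`): the constant `1.2569` below is the 4-decimal ceiling. [folklore] -/
private theorem lt_three_sub_cot_sq_two_pi_div_nine :
    1.2568 ^ 2 < 3 - Real.cot (2 * π / 9) ^ 2 := by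
  have hc := cos_two_pi_div_nine_lt
  have hc1 := lt_cos_two_pi_div_nine
  have hs : 0 < Real.sin (2 * π / 9) :=
    sin_pos_of_pos_of_lt_pi (by positivity) (by linarith [pi_pos])
  have hs2 : Real.sin (2 * π / 9) ^ 2 = 1 - Real.cos (2 * π / 9) ^ 2 := Real.sin_sq _
  rw [Real.cot_eq_cos_div_sin, div_pow, lt_sub_comm, div_lt_iff₀ (pow_pos hs 2), hs2]
  have hc0 : 0 < Real.cos (2 * π / 9) := by linarith
  nlinarith [mul_lt_mul'' hc hc hc0.le hc0.le]

/-- **Fejes Tóth's bound at `N = 8`**: `d₈ ≤ √(3 − cot² (2π/9)) = √(3 − cot² 40°)`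
(`ω₈ = 8π/(6·6) = 40°`). [cite: FejesToth1943Tammes, (1) p. 66, n = 8]
[cite: MusinTarasov2015, §3.2 (d_N ≤ arccos((ctg² ω_N − 1)/2), ω_N = πN/(6N − 12))] -/
theorem maxMinDist_eight_le_sqrt :
    maxMinDist 8 (EuclideanSpace ℝ (Fin 3)) ≤ Real.sqrt (3 - Real.cot (2 * π / 9) ^ 2) := by
  have h := maxMinDist_le_fejesToth (N := 8) (by norm_num)
  rwa [show ((8 : ℕ) : ℝ) * π / (6 * ((8 : ℕ) - 2)) = 2 * π / 9 by push_cast; ring] at h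

/-- **The numerical value of Fejes Tóth's bound for eight points**:
`1.2568 < √(3 − cot² 40°) < 1.2569` (`= 1.256870…`, the chord of `77.8695°`).
[cite: MusinTarasov2015, Table 7.2 (N = 7, maximal graph: d_max = 1.35908 rad = 77.8695°, whose
chord 2 sin(d/2) is 1.25687; = Fejes Tóth's bound for N = 8 since cot 40° cot 80° = (cot² 40° − 1)/2)] -/
theorem sqrt_three_sub_cot_sq_two_pi_div_nine_mem_Ioo :
    Real.sqrt (3 - Real.cot (2 * π / 9) ^ 2) ∈ Set.Ioo (1.2568 : ℝ) 1.2569 := by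
  constructor
  · exact (Real.lt_sqrt (by norm_num)).2 lt_three_sub_cot_sq_two_pi_div_nine
  · exact (Real.sqrt_lt' (by norm_num)).2 three_sub_cot_sq_two_pi_div_nine_lt

/-- **`d₈ < 1.2569`** (chordal; angular: `d₈ ≤ 77.8695° < 77.88°`): Fejes Tóth's bound for
eight points, evaluated. [cite: FejesToth1943Tammes, (1) p. 66, n = 8]
[cite: MusinTarasov2015, §3.2 and Table 7.2] -/
theorem maxMinDist_eight_lt : maxMinDist 8 (EuclideanSpace ℝ (Fin 3)) < 1.2569 :=
  maxMinDist_eight_le_sqrt.trans_lt sqrt_three_sub_cot_sq_two_pi_div_nine_mem_Ioo.2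

/-- Hence **every arrangement of eight unit vectors of `ℝ³` has two at (chordal) distance
`< 1.2569`** — `ψ(x) < 1.2569` for every `x`; in particular eight unit vectors with pairwise
distances `≥ 1.26` (angular separation `≥ 78.10°`) do not exist.
[cite: FejesToth1943Tammes, (1) p. 66, n = 8] -/
theorem minDist_eight_lt {x : Fin 8 → EuclideanSpace ℝ (Fin 3)}
    (hx : x ∈ unitConfigs 8 (EuclideanSpace ℝ (Fin 3))) : minDist x < 1.2569 :=
  (minDist_le_maxMinDist hx).trans_lt maxMinDist_eight_lt

/-- **Finite-set reading**: a finite set of at least eight points of the unit sphere of `ℝ³`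
contains two distinct points at distance `< 1.2569`.
[cite: FejesToth1943Tammes, (1) p. 66, n = 8] -/
theorem exists_dist_lt_of_eight_le_card {T : Finset (EuclideanSpace ℝ (Fin 3))}
    (hT : ∀ v ∈ T, ‖v‖ = 1) (h8 : 8 ≤ T.card) :
    ∃ v ∈ T, ∃ w ∈ T, v ≠ w ∧ dist v w < 1.2569 := by
  obtain ⟨S, hST, hS⟩ := Finset.exists_subset_card_eq h8
  obtain ⟨v, hv, w, hw, hne, hd⟩ :=
    exists_dist_le_maxMinDist (T := S) (fun v hv => hT v (hST hv)) (by omega)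
  rw [hS] at hd
  exact ⟨v, hST hv, w, hST hw, hne, hd.trans_lt maxMinDist_eight_lt⟩

end Literature.Geometry.DiscreteGeometry

end
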